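import Summits.ValiantsHypothesis.ValiantsHypothesis.Theorems.LacunarySymmetroidMatrixDescartesPivotRankOneOneThreeKillEightOdd

/-!
# `MatrixDescartes` census — rank-one `(2,4)₁`, ONE below / THREE above, chamber (C): `Z₊ ≤ 7` BY PARITY, the top triples
# ((C₂), (C₃) of `…PivotRankOneOneThreeKillEight` with the kills counted WITH multiplicity; companion of `…OneThreeKillEightOdd`)

HONEST FRAMING.  Object-search cell `pub-symmetroid`, seat `val-sym-mdr-p1` (generation 26); helper file `--supports` the crux item
stmt-ValiantsHypothesis-18050 (`Theses.LacunarySymmetroid.MatrixDescartes`, OPEN, on HOLD) with NO closure claim.  As the companion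
`…PivotRankOneOneThreeKillEightOdd` (§0 there: the `1|3` eleven-nomial has an ODD number of positive roots with multiplicity when letter `0`
is core and letters `2, 3` are not parallel): the generation-14 circuit conditions (C₂) (triple `(d₀+d₃, e+d₂, d₁+d₂)`) and (C₃) (triple
`(d₁+d₂, e+d₃, d₁+d₃)`), with the eight kills counted WITH multiplicity (`…PivotKillMultiplicity.countP_posRoots_le_kills`) and the
multiplicity-aware circuit lemma, give `pos ≤ 8` with multiplicity, and parity gives **`Z₊ ≤ 7`** — the SEVEN object's value.  The located
remainder of chamber (C) without any kill certificate stays OPEN; nothing is claimed there.  Nothing here bears on `MatrixDescartes` in its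
window, on `DoorA26` / `DoorA34`, registers / credences, or `VP ≠ VNP`.

[folklore] As the companion: tree kill engine with multiplicity, circuit number [cite: IlimanDewolff2016, Theorem 3.8 (n = 1)], Descartes'
parity [cite: BasuPollackRoy2006, Thm. 2.33]; the kill bookkeeping is the generation-14 text verbatim with the two engine lemmas replaced.
No definitions, no named facts.
-/

-- `Summit.ValiantsHypothesis.ValiantsHypothesis.…` repeats a component by the D-0017 layout
-- (single-conjunct summit), which the `dupNamespace` linter flags; the name is mandated.
set_option linter.dupNamespace false

namespace Summit.ValiantsHypothesis.ValiantsHypothesis.Theorems.LacunarySymmetroidMatrixDescartes.Pivot.TwoDirections.BlockLaw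

open Polynomial Matrix Finset
open scoped BigOperators
open Summit.ValiantsHypothesis.ValiantsHypothesis.Theorems.LacunarySymmetroidMatrixDescartes.Pivot.KillMult
  (countP_posRoots_le_kills odd_countP_posRoots card_posRoots_le_pred_of_odd)
open Summit.ValiantsHypothesis.ValiantsHypothesis.Theorems.LacunarySymmetroidMatrixDescartes.Census
  (countP_posRoots_trinomial_eq_zero_of_circuit)

/-! ## 1. (C₂) -/

/-- **(C₂): the letter-`2` term at `e+d₂` against the pair terms at `d₀+d₃`, `d₁+d₂`, chamber (C): `Z₊ ≤ 7`.**  As the tree's `elevenNomial_chamberC_C2_le_eight` (same exponent hypotheses and circuit condition; coefficient data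
otherwise arbitrary), plus the two sign hypotheses that make the count odd — letter `0` core (`m₀ < 0`) and letters `2, 3` not parallel
(`D₂₃ > 0`): eight kills counted WITH multiplicity leave a root-free circuit trinomial, so `pos ≤ 8` with multiplicity, and parity gives `7`. -/
theorem elevenNomial_chamberC_C2_le_seven (e d₀ d₁ d₂ d₃ : ℕ) (h0e : d₀ < e) (he1 : e < d₁) (h12 : d₁ < d₂) (h23 : d₂ < d₃)
    (hC4 : e + d₁ < d₀ + d₃) (hC5 : d₀ + d₃ < e + d₂) (hC6 : d₁ + d₂ < e + d₃)
    (dJ m₀ m₁ m₂ m₃ w₀ w₁ w₂ w₃ D01 D02 D03 D12 D13 D23 : ℝ) (hw₀ : 0 < w₀) (hw₁ : 0 < w₁) (hw₂ : 0 < w₂) (hw₃ : 0 < w₃) (hD03 : 0 < D03) (hD12 : 0 < D12) (hm₀ : m₀ < 0) (hD23 : 0 < D23)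
    (hcirc : (w₂ * (-m₂)
        * (((d₂ : ℝ) - e) * ((d₂ : ℝ) - d₀) * ((d₂ : ℝ) - d₁) * ((d₃ : ℝ) - d₂) * ((e : ℝ) + d₂ - d₀ - d₁) * ((e : ℝ) - d₀) * ((d₁ : ℝ) + d₃ - e - d₂) * ((d₃ : ℝ) - e))) ^ ((e + d₂) - d₀ - d₃ + (d₁ - e)) * ((((d₁ - e : ℕ) : ℝ)) ^ (d₁ - e) * ((((e + d₂) - d₀ - d₃ : ℕ) : ℝ)) ^ ((e + d₂) - d₀ - d₃))
      < ((((e + d₂) - d₀ - d₃ + (d₁ - e) : ℕ) : ℝ)) ^ ((e + d₂) - d₀ - d₃ + (d₁ - e))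
        * ((w₀ * w₃ * D03
          * (((d₀ : ℝ) + d₃ - 2 * e) * ((d₃ : ℝ) - e) * ((d₀ : ℝ) + d₃ - e - d₁) * ((e : ℝ) - d₀) * ((d₃ : ℝ) - d₁) * ((d₃ : ℝ) - d₂) * ((d₁ : ℝ) - d₀) * ((d₂ : ℝ) - d₀))) ^ (d₁ - e)
          * (w₁ * w₂ * D12
          * (((d₁ : ℝ) + d₂ - 2 * e) * ((d₁ : ℝ) + d₂ - e - d₀) * ((d₂ : ℝ) - e) * ((e : ℝ) + d₃ - d₁ - d₂) * ((d₂ : ℝ) - d₀) * ((d₁ : ℝ) - d₀) * ((d₃ : ℝ) - d₂) * ((d₃ : ℝ) - d₁))) ^ ((e + d₂) - d₀ - d₃))) :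
    ((∑ i : Fin 11, Polynomial.C ((![dJ, w₀ * m₀, w₁ * m₁, w₂ * m₂, w₃ * m₃, w₀ * w₁ * D01, w₀ * w₂ * D02, w₀ * w₃ * D03, w₁ * w₂ * D12, w₁ * w₃ * D13, w₂ * w₃ * D23] : Fin 11 → ℝ) i) * X ^ ((![2 * e, e + d₀, e + d₁, e + d₂, e + d₃, d₀ + d₁, d₀ + d₂, d₀ + d₃, d₁ + d₂, d₁ + d₃, d₂ + d₃] : Fin 11 → ℕ) i)).roots.toFinset.filter (fun t => 0 < t)).card ≤ 7 := by
  classical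
  have h8 : (∑ i : Fin 11, Polynomial.C ((![dJ, w₀ * m₀, w₁ * m₁, w₂ * m₂, w₃ * m₃, w₀ * w₁ * D01, w₀ * w₂ * D02, w₀ * w₃ * D03, w₁ * w₂ * D12, w₁ * w₃ * D13, w₂ * w₃ * D23] : Fin 11 → ℝ) i) * X ^ ((![2 * e, e + d₀, e + d₁, e + d₂, e + d₃, d₀ + d₁, d₀ + d₂, d₀ + d₃, d₁ + d₂, d₁ + d₃, d₂ + d₃] : Fin 11 → ℕ) i)).roots.countP (fun x => 0 < x) ≤ 8 := by
    have h0e' : (d₀ : ℝ) < e := by exact_mod_cast h0e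
    have he1' : (e : ℝ) < d₁ := by exact_mod_cast he1
    have h12' : (d₁ : ℝ) < d₂ := by exact_mod_cast h12
    have h23' : (d₂ : ℝ) < d₃ := by exact_mod_cast h23
    have hC4' : (e : ℝ) + d₁ < d₀ + d₃ := by exact_mod_cast hC4
    have hC5' : (d₀ : ℝ) + d₃ < e + d₂ := by exact_mod_cast hC5
    have hC6' : (d₁ : ℝ) + d₂ < e + d₃ := by exact_mod_cast hC6
    -- the three distance products
    obtain ⟨PA, hPA⟩ : ∃ x : ℝ, x = ((d₀ : ℝ) + d₃ - 2 * e) * ((d₃ : ℝ) - e) * ((d₀ : ℝ) + d₃ - e - d₁) * ((e : ℝ) - d₀) * ((d₃ : ℝ) - d₁) * ((d₃ : ℝ) - d₂) * ((d₁ : ℝ) - d₀) * ((d₂ : ℝ) - d₀) := ⟨_, rfl⟩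
    obtain ⟨PB, hPB⟩ : ∃ x : ℝ, x = ((d₂ : ℝ) - e) * ((d₂ : ℝ) - d₀) * ((d₂ : ℝ) - d₁) * ((d₃ : ℝ) - d₂) * ((e : ℝ) + d₂ - d₀ - d₁) * ((e : ℝ) - d₀) * ((d₁ : ℝ) + d₃ - e - d₂) * ((d₃ : ℝ) - e) := ⟨_, rfl⟩
    obtain ⟨PC, hPC⟩ : ∃ x : ℝ, x = ((d₁ : ℝ) + d₂ - 2 * e) * ((d₁ : ℝ) + d₂ - e - d₀) * ((d₂ : ℝ) - e) * ((e : ℝ) + d₃ - d₁ - d₂) * ((d₂ : ℝ) - d₀) * ((d₁ : ℝ) - d₀) * ((d₃ : ℝ) - d₂) * ((d₃ : ℝ) - d₁) := ⟨_, rfl⟩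
    have hPAp : 0 < PA := by
      rw [hPA]
      have f1 : 0 < ((d₀ : ℝ) + d₃ - 2 * e) := by linarith
      have f2 : 0 < ((d₃ : ℝ) - e) := by linarith
      have f3 : 0 < ((d₀ : ℝ) + d₃ - e - d₁) := by linarith
      have f4 : 0 < ((e : ℝ) - d₀) := by linarith
      have f5 : 0 < ((d₃ : ℝ) - d₁) := by linarith
      have f6 : 0 < ((d₃ : ℝ) - d₂) := by linarith
      have f7 : 0 < ((d₁ : ℝ) - d₀) := by linarith
      have f8 : 0 < ((d₂ : ℝ) - d₀) := by linarith
      exact mul_pos (mul_pos (mul_pos (mul_pos (mul_pos (mul_pos (mul_pos f1 f2) f3) f4) f5) f6) f7) f8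
    have hPCp : 0 < PC := by
      rw [hPC]
      have f1 : 0 < ((d₁ : ℝ) + d₂ - 2 * e) := by linarith
      have f2 : 0 < ((d₁ : ℝ) + d₂ - e - d₀) := by linarith
      have f3 : 0 < ((d₂ : ℝ) - e) := by linarith
      have f4 : 0 < ((e : ℝ) + d₃ - d₁ - d₂) := by linarith
      have f5 : 0 < ((d₂ : ℝ) - d₀) := by linarith
      have f6 : 0 < ((d₁ : ℝ) - d₀) := by linarith
      have f7 : 0 < ((d₃ : ℝ) - d₂) := by linarith
      have f8 : 0 < ((d₃ : ℝ) - d₁) := by linarith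
      exact mul_pos (mul_pos (mul_pos (mul_pos (mul_pos (mul_pos (mul_pos f1 f2) f3) f4) f5) f6) f7) f8
    -- the three surviving coefficients
    obtain ⟨A, hA⟩ : ∃ x : ℝ, x = w₀ * w₃ * D03 * PA := ⟨_, rfl⟩
    obtain ⟨B, hB⟩ : ∃ x : ℝ, x = w₂ * (-m₂) * PB := ⟨_, rfl⟩
    obtain ⟨C, hC⟩ : ∃ x : ℝ, x = w₁ * w₂ * D12 * PC := ⟨_, rfl⟩
    have hAp : 0 < A := by rw [hA]; exact mul_pos (mul_pos (mul_pos hw₀ hw₃) hD03) hPAp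
    have hCp : 0 < C := by rw [hC]; exact mul_pos (mul_pos (mul_pos hw₁ hw₂) hD12) hPCp
    have hcirc' : B ^ ((e + d₂) - d₀ - d₃ + (d₁ - e)) * ((((d₁ - e : ℕ) : ℝ)) ^ (d₁ - e) * ((((e + d₂) - d₀ - d₃ : ℕ) : ℝ)) ^ ((e + d₂) - d₀ - d₃)) < ((((e + d₂) - d₀ - d₃ + (d₁ - e) : ℕ) : ℝ)) ^ ((e + d₂) - d₀ - d₃ + (d₁ - e)) * (A ^ (d₁ - e) * C ^ ((e + d₂) - d₀ - d₃)) := by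
      rw [hA, hB, hC, hPA, hPB, hPC]; exact hcirc
    clear hcirc
    -- eight kills
    have hkills := countP_posRoots_le_kills (Finset.univ : Finset (Fin 11)) (![2 * e, e + d₀, e + d₁, e + d₂, e + d₃, d₀ + d₁, d₀ + d₂, d₀ + d₃, d₁ + d₂, d₁ + d₃, d₂ + d₃] : Fin 11 → ℕ) [2 * e, e + d₀, e + d₁, e + d₃, d₀ + d₁, d₀ + d₂, d₁ + d₃, d₂ + d₃] (![dJ, w₀ * m₀, w₁ * m₁, w₂ * m₂, w₃ * m₃, w₀ * w₁ * D01, w₀ * w₂ * D02, w₀ * w₃ * D03, w₁ * w₂ * D12, w₁ * w₃ * D13, w₂ * w₃ * D23] : Fin 11 → ℝ)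
    have htri : (∑ i ∈ (Finset.univ : Finset (Fin 11)), Polynomial.C ((![dJ, w₀ * m₀, w₁ * m₁, w₂ * m₂, w₃ * m₃, w₀ * w₁ * D01, w₀ * w₂ * D02, w₀ * w₃ * D03, w₁ * w₂ * D12, w₁ * w₃ * D13, w₂ * w₃ * D23] : Fin 11 → ℝ) i
            * (([2 * e, e + d₀, e + d₁, e + d₃, d₀ + d₁, d₀ + d₂, d₁ + d₃, d₂ + d₃]).map (fun ρ : ℕ => (((((![2 * e, e + d₀, e + d₁, e + d₂, e + d₃, d₀ + d₁, d₀ + d₂, d₀ + d₃, d₁ + d₂, d₁ + d₃, d₂ + d₃] : Fin 11 → ℕ)) i : ℕ) : ℝ) - (ρ : ℝ)))).prod) * X ^ ((![2 * e, e + d₀, e + d₁, e + d₂, e + d₃, d₀ + d₁, d₀ + d₂, d₀ + d₃, d₁ + d₂, d₁ + d₃, d₂ + d₃] : Fin 11 → ℕ) i))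
        = -(Polynomial.C A * X ^ (d₀ + d₃) - Polynomial.C B * X ^ (d₀ + d₃ + ((e + d₂) - d₀ - d₃)) + Polynomial.C C * X ^ (d₀ + d₃ + ((e + d₂) - d₀ - d₃) + (d₁ - e))) := by
      have e1 : d₀ + d₃ + ((e + d₂) - d₀ - d₃) = e + d₂ := by omega
      have e2 : d₀ + d₃ + ((e + d₂) - d₀ - d₃) + (d₁ - e) = d₁ + d₂ := by omega
      rw [e2, e1]
      have hcoef : ∀ i : Fin 11, (![dJ, w₀ * m₀, w₁ * m₁, w₂ * m₂, w₃ * m₃, w₀ * w₁ * D01, w₀ * w₂ * D02, w₀ * w₃ * D03, w₁ * w₂ * D12, w₁ * w₃ * D13, w₂ * w₃ * D23] : Fin 11 → ℝ) i * (([2 * e, e + d₀, e + d₁, e + d₃, d₀ + d₁, d₀ + d₂, d₁ + d₃, d₂ + d₃]).map (fun ρ : ℕ => (((((![2 * e, e + d₀, e + d₁, e + d₂, e + d₃, d₀ + d₁, d₀ + d₂, d₀ + d₃, d₁ + d₂, d₁ + d₃, d₂ + d₃] : Fin 11 → ℕ)) i : ℕ) : ℝ) - (ρ : ℝ)))).p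rod
          = (![0, 0, 0, B, 0, 0, 0, -A, -C, 0, 0] : Fin 11 → ℝ) i := by
        intro i
        fin_cases i <;>
          simp only [Fin.zero_eta, Fin.mk_one, Fin.isValue, Matrix.cons_val_zero, Matrix.cons_val_one,
            List.map_cons, List.map_nil, List.prod_cons, List.prod_nil, hA, hB, hC, hPA, hPB, hPC] <;>
          push_cast <;> ring
      rw [Finset.sum_congr rfl (fun i _ => by rw [hcoef i])]
      simp only [Fin.sum_univ_succ, Fin.sum_univ_zero, Matrix.cons_val_zero, Matrix.cons_val_succ, map_zero, zero_mul,
        zero_add, add_zero, Polynomial.C_neg]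
      ring
    rw [htri, Polynomial.roots_neg] at hkills
    have hzero := countP_posRoots_trinomial_eq_zero_of_circuit A B C (d₀ + d₃) ((e + d₂) - d₀ - d₃) (d₁ - e) hAp hCp (by omega) (by omega) (Or.inr hcirc')
    simp only [List.length_cons, List.length_nil] at hkills
    omega
  have hodd := elevenNomial_oneThree_odd e d₀ d₁ d₂ d₃ h0e he1 h12 h23 dJ m₀ m₁ m₂ m₃ w₀ w₁ w₂ w₃ D01 D02 D03 D12 D13 D23
    (mul_neg_of_pos_of_neg hw₀ hm₀) (mul_pos (mul_pos hw₂ hw₃) hD23)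
  have h7 := card_posRoots_le_pred_of_odd _ 4 hodd (by omega)
  omega


/-! ## 2. (C₃) -/

/-- **(C₃): the letter-`3` term at `e+d₃` against the pair terms at `d₁+d₂`, `d₁+d₃`, chamber (C): `Z₊ ≤ 7`.**  As the tree's `elevenNomial_chamberC_C3_le_eight` (same exponent hypotheses and circuit condition; coefficient data
otherwise arbitrary), plus the two sign hypotheses that make the count odd — letter `0` core (`m₀ < 0`) and letters `2, 3` not parallel
(`D₂₃ > 0`): eight kills counted WITH multiplicity leave a root-free circuit trinomial, so `pos ≤ 8` with multiplicity, and parity gives `7`. -/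
theorem elevenNomial_chamberC_C3_le_seven (e d₀ d₁ d₂ d₃ : ℕ) (h0e : d₀ < e) (he1 : e < d₁) (h12 : d₁ < d₂) (h23 : d₂ < d₃)
    (hC5 : d₀ + d₃ < e + d₂) (hC6 : d₁ + d₂ < e + d₃)
    (dJ m₀ m₁ m₂ m₃ w₀ w₁ w₂ w₃ D01 D02 D03 D12 D13 D23 : ℝ) (hw₁ : 0 < w₁) (hw₂ : 0 < w₂) (hw₃ : 0 < w₃) (hD12 : 0 < D12) (hD13 : 0 < D13) (hw₀ : 0 < w₀) (hm₀ : m₀ < 0) (hD23 : 0 < D23)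
    (hcirc : (w₃ * (-m₃)
        * (((d₃ : ℝ) - e) * ((d₃ : ℝ) - d₀) * ((d₃ : ℝ) - d₁) * ((d₃ : ℝ) - d₂) * ((e : ℝ) + d₃ - d₀ - d₁) * ((e : ℝ) + d₃ - d₀ - d₂) * ((e : ℝ) - d₀) * ((d₂ : ℝ) - e))) ^ ((e + d₃) - d₁ - d₂ + (d₁ - e)) * ((((d₁ - e : ℕ) : ℝ)) ^ (d₁ - e) * ((((e + d₃) - d₁ - d₂ : ℕ) : ℝ)) ^ ((e + d₃) - d₁ - d₂))
      < ((((e + d₃) - d₁ - d₂ + (d₁ - e) : ℕ) : ℝ)) ^ ((e + d₃) - d₁ - d₂ + (d₁ - e))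
        * ((w₁ * w₂ * D12
          * (((d₁ : ℝ) + d₂ - 2 * e) * ((d₁ : ℝ) + d₂ - e - d₀) * ((d₂ : ℝ) - e) * ((d₁ : ℝ) - e) * ((d₂ : ℝ) - d₀) * ((d₁ : ℝ) - d₀) * ((d₁ : ℝ) + d₂ - d₀ - d₃) * ((d₃ : ℝ) - d₁))) ^ (d₁ - e)
          * (w₁ * w₃ * D13
          * (((d₁ : ℝ) + d₃ - 2 * e) * ((d₁ : ℝ) + d₃ - e - d₀) * ((d₃ : ℝ) - e) * ((d₁ : ℝ) + d₃ - e - d₂) * ((d₃ : ℝ) - d₀) * ((d₁ : ℝ) + d₃ - d₀ - d₂) * ((d₁ : ℝ) - d₀) * ((d₂ : ℝ) - d₁))) ^ ((e + d₃) - d₁ - d₂))) :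
    ((∑ i : Fin 11, Polynomial.C ((![dJ, w₀ * m₀, w₁ * m₁, w₂ * m₂, w₃ * m₃, w₀ * w₁ * D01, w₀ * w₂ * D02, w₀ * w₃ * D03, w₁ * w₂ * D12, w₁ * w₃ * D13, w₂ * w₃ * D23] : Fin 11 → ℝ) i) * X ^ ((![2 * e, e + d₀, e + d₁, e + d₂, e + d₃, d₀ + d₁, d₀ + d₂, d₀ + d₃, d₁ + d₂, d₁ + d₃, d₂ + d₃] : Fin 11 → ℕ) i)).roots.toFinset.filter (fun t => 0 < t)).card ≤ 7 := by
  classical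
  have h8 : (∑ i : Fin 11, Polynomial.C ((![dJ, w₀ * m₀, w₁ * m₁, w₂ * m₂, w₃ * m₃, w₀ * w₁ * D01, w₀ * w₂ * D02, w₀ * w₃ * D03, w₁ * w₂ * D12, w₁ * w₃ * D13, w₂ * w₃ * D23] : Fin 11 → ℝ) i) * X ^ ((![2 * e, e + d₀, e + d₁, e + d₂, e + d₃, d₀ + d₁, d₀ + d₂, d₀ + d₃, d₁ + d₂, d₁ + d₃, d₂ + d₃] : Fin 11 → ℕ) i)).roots.countP (fun x => 0 < x) ≤ 8 := by
    have h0e' : (d₀ : ℝ) < e := by exact_mod_cast h0e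
    have he1' : (e : ℝ) < d₁ := by exact_mod_cast he1
    have h12' : (d₁ : ℝ) < d₂ := by exact_mod_cast h12
    have h23' : (d₂ : ℝ) < d₃ := by exact_mod_cast h23
    have hC5' : (d₀ : ℝ) + d₃ < e + d₂ := by exact_mod_cast hC5
    have hC6' : (d₁ : ℝ) + d₂ < e + d₃ := by exact_mod_cast hC6
    -- the three distance products
    obtain ⟨PA, hPA⟩ : ∃ x : ℝ, x = ((d₁ : ℝ) + d₂ - 2 * e) * ((d₁ : ℝ) + d₂ - e - d₀) * ((d₂ : ℝ) - e) * ((d₁ : ℝ) - e) * ((d₂ : ℝ) - d₀) * ((d₁ : ℝ) - d₀) * ((d₁ : ℝ) + d₂ - d₀ - d₃) * ((d₃ : ℝ) - d₁) := ⟨_, rfl⟩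
    obtain ⟨PB, hPB⟩ : ∃ x : ℝ, x = ((d₃ : ℝ) - e) * ((d₃ : ℝ) - d₀) * ((d₃ : ℝ) - d₁) * ((d₃ : ℝ) - d₂) * ((e : ℝ) + d₃ - d₀ - d₁) * ((e : ℝ) + d₃ - d₀ - d₂) * ((e : ℝ) - d₀) * ((d₂ : ℝ) - e) := ⟨_, rfl⟩
    obtain ⟨PC, hPC⟩ : ∃ x : ℝ, x = ((d₁ : ℝ) + d₃ - 2 * e) * ((d₁ : ℝ) + d₃ - e - d₀) * ((d₃ : ℝ) - e) * ((d₁ : ℝ) + d₃ - e - d₂) * ((d₃ : ℝ) - d₀) * ((d₁ : ℝ) + d₃ - d₀ - d₂) * ((d₁ : ℝ) - d₀) * ((d₂ : ℝ) - d₁) := ⟨_, rfl⟩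
    have hPAp : 0 < PA := by
      rw [hPA]
      have f1 : 0 < ((d₁ : ℝ) + d₂ - 2 * e) := by linarith
      have f2 : 0 < ((d₁ : ℝ) + d₂ - e - d₀) := by linarith
      have f3 : 0 < ((d₂ : ℝ) - e) := by linarith
      have f4 : 0 < ((d₁ : ℝ) - e) := by linarith
      have f5 : 0 < ((d₂ : ℝ) - d₀) := by linarith
      have f6 : 0 < ((d₁ : ℝ) - d₀) := by linarith
      have f7 : 0 < ((d₁ : ℝ) + d₂ - d₀ - d₃) := by linarith
      have f8 : 0 < ((d₃ : ℝ) - d₁) := by linarith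
      exact mul_pos (mul_pos (mul_pos (mul_pos (mul_pos (mul_pos (mul_pos f1 f2) f3) f4) f5) f6) f7) f8
    have hPCp : 0 < PC := by
      rw [hPC]
      have f1 : 0 < ((d₁ : ℝ) + d₃ - 2 * e) := by linarith
      have f2 : 0 < ((d₁ : ℝ) + d₃ - e - d₀) := by linarith
      have f3 : 0 < ((d₃ : ℝ) - e) := by linarith
      have f4 : 0 < ((d₁ : ℝ) + d₃ - e - d₂) := by linarith
      have f5 : 0 < ((d₃ : ℝ) - d₀) := by linarith
      have f6 : 0 < ((d₁ : ℝ) + d₃ - d₀ - d₂) := by linarith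
      have f7 : 0 < ((d₁ : ℝ) - d₀) := by linarith
      have f8 : 0 < ((d₂ : ℝ) - d₁) := by linarith
      exact mul_pos (mul_pos (mul_pos (mul_pos (mul_pos (mul_pos (mul_pos f1 f2) f3) f4) f5) f6) f7) f8
    -- the three surviving coefficients
    obtain ⟨A, hA⟩ : ∃ x : ℝ, x = w₁ * w₂ * D12 * PA := ⟨_, rfl⟩
    obtain ⟨B, hB⟩ : ∃ x : ℝ, x = w₃ * (-m₃) * PB := ⟨_, rfl⟩
    obtain ⟨C, hC⟩ : ∃ x : ℝ, x = w₁ * w₃ * D13 * PC := ⟨_, rfl⟩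
    have hAp : 0 < A := by rw [hA]; exact mul_pos (mul_pos (mul_pos hw₁ hw₂) hD12) hPAp
    have hCp : 0 < C := by rw [hC]; exact mul_pos (mul_pos (mul_pos hw₁ hw₃) hD13) hPCp
    have hcirc' : B ^ ((e + d₃) - d₁ - d₂ + (d₁ - e)) * ((((d₁ - e : ℕ) : ℝ)) ^ (d₁ - e) * ((((e + d₃) - d₁ - d₂ : ℕ) : ℝ)) ^ ((e + d₃) - d₁ - d₂)) < ((((e + d₃) - d₁ - d₂ + (d₁ - e) : ℕ) : ℝ)) ^ ((e + d₃) - d₁ - d₂ + (d₁ - e)) * (A ^ (d₁ - e) * C ^ ((e + d₃) - d₁ - d₂)) := by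
      rw [hA, hB, hC, hPA, hPB, hPC]; exact hcirc
    clear hcirc
    -- eight kills
    have hkills := countP_posRoots_le_kills (Finset.univ : Finset (Fin 11)) (![2 * e, e + d₀, e + d₁, e + d₂, e + d₃, d₀ + d₁, d₀ + d₂, d₀ + d₃, d₁ + d₂, d₁ + d₃, d₂ + d₃] : Fin 11 → ℕ) [2 * e, e + d₀, e + d₁, e + d₂, d₀ + d₁, d₀ + d₂, d₀ + d₃, d₂ + d₃] (![dJ, w₀ * m₀, w₁ * m₁, w₂ * m₂, w₃ * m₃, w₀ * w₁ * D01, w₀ * w₂ * D02, w₀ * w₃ * D03, w₁ * w₂ * D12, w₁ * w₃ * D13, w₂ * w₃ * D23] : Fin 11 → ℝ)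
    have htri : (∑ i ∈ (Finset.univ : Finset (Fin 11)), Polynomial.C ((![dJ, w₀ * m₀, w₁ * m₁, w₂ * m₂, w₃ * m₃, w₀ * w₁ * D01, w₀ * w₂ * D02, w₀ * w₃ * D03, w₁ * w₂ * D12, w₁ * w₃ * D13, w₂ * w₃ * D23] : Fin 11 → ℝ) i
            * (([2 * e, e + d₀, e + d₁, e + d₂, d₀ + d₁, d₀ + d₂, d₀ + d₃, d₂ + d₃]).map (fun ρ : ℕ => (((((![2 * e, e + d₀, e + d₁, e + d₂, e + d₃, d₀ + d₁, d₀ + d₂, d₀ + d₃, d₁ + d₂, d₁ + d₃, d₂ + d₃] : Fin 11 → ℕ)) i : ℕ) : ℝ) - (ρ : ℝ)))).prod) * X ^ ((![2 * e, e + d₀, e + d₁, e + d₂, e + d₃, d₀ + d₁, d₀ + d₂, d₀ + d₃, d₁ + d₂, d₁ + d₃, d₂ + d₃] : Fin 11 → ℕ) i))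
        = -(Polynomial.C A * X ^ (d₁ + d₂) - Polynomial.C B * X ^ (d₁ + d₂ + ((e + d₃) - d₁ - d₂)) + Polynomial.C C * X ^ (d₁ + d₂ + ((e + d₃) - d₁ - d₂) + (d₁ - e))) := by
      have e1 : d₁ + d₂ + ((e + d₃) - d₁ - d₂) = e + d₃ := by omega
      have e2 : d₁ + d₂ + ((e + d₃) - d₁ - d₂) + (d₁ - e) = d₁ + d₃ := by omega
      rw [e2, e1]
      have hcoef : ∀ i : Fin 11, (![dJ, w₀ * m₀, w₁ * m₁, w₂ * m₂, w₃ * m₃, w₀ * w₁ * D01, w₀ * w₂ * D02, w₀ * w₃ * D03, w₁ * w₂ * D12, w₁ * w₃ * D13, w₂ * w₃ * D23] : Fin 11 → ℝ) i * (([2 * e, e + d₀, e + d₁, e + d₂, d₀ + d₁, d₀ + d₂, d₀ + d₃, d₂ + d₃]).map (fun ρ : ℕ => (((((![2 * e, e + d₀, e + d₁, e + d₂, e + d₃, d₀ + d₁, d₀ + d₂, d₀ + d₃, d₁ + d₂, d₁ + d₃, d₂ + d₃] : Fin 11 → ℕ)) i : ℕ) : ℝ) - (ρ : ℝ)))).p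rod
          = (![0, 0, 0, 0, B, 0, 0, 0, -A, -C, 0] : Fin 11 → ℝ) i := by
        intro i
        fin_cases i <;>
          simp only [Fin.zero_eta, Fin.mk_one, Fin.isValue, Matrix.cons_val_zero, Matrix.cons_val_one,
            List.map_cons, List.map_nil, List.prod_cons, List.prod_nil, hA, hB, hC, hPA, hPB, hPC] <;>
          push_cast <;> ring
      rw [Finset.sum_congr rfl (fun i _ => by rw [hcoef i])]
      simp only [Fin.sum_univ_succ, Fin.sum_univ_zero, Matrix.cons_val_zero, Matrix.cons_val_succ, map_zero, zero_mul,
        zero_add, add_zero, Polynomial.C_neg]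
      ring
    rw [htri, Polynomial.roots_neg] at hkills
    have hzero := countP_posRoots_trinomial_eq_zero_of_circuit A B C (d₁ + d₂) ((e + d₃) - d₁ - d₂) (d₁ - e) hAp hCp (by omega) (by omega) (Or.inr hcirc')
    simp only [List.length_cons, List.length_nil] at hkills
    omega
  have hodd := elevenNomial_oneThree_odd e d₀ d₁ d₂ d₃ h0e he1 h12 h23 dJ m₀ m₁ m₂ m₃ w₀ w₁ w₂ w₃ D01 D02 D03 D12 D13 D23
    (mul_neg_of_pos_of_neg hw₀ hm₀) (mul_pos (mul_pos hw₂ hw₃) hD23)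
  have h7 := card_posRoots_le_pred_of_odd _ 4 hodd (by omega)
  omega

end Summit.ValiantsHypothesis.ValiantsHypothesis.Theorems.LacunarySymmetroidMatrixDescartes.Pivot.TwoDirections.BlockLaw
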